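import Summits.QuantumFields.YangMills.Theorems.BalabanUVNodesPortS1G3CClose

/-!
# NODE O port PT-A — THE RESUMMED RESOLVENT PIECES OF `stub_G3C` WITH (g1) AT EVERY PAIR (g11 docket 1, part C companion): `G3CAtRecordL`'s conclusion ∧ the collector identity
# `Σ_X EG x n X φ = Tr (x + [TC n φ]_{non-b₀})⁻¹` FOR EVERY pair `φ` — the hand's construction (✓`g3cAtRecordL_holds`) verbatim, the pointwise clause ✓`sum_g3cEG` kept instead of filtered to the germ

Cell `ym-nodeO-ideate`, porter seat PT-A-1 (gen 11); `--kind proof --supports stmt-QuantumFields-27930 --as helper`; count-neutral.  [16] = [Balaban1985UV3]; [B9] = [Balaban1985BackgroundPropagators].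

WHY.  The ε₀-class edition of the Gaussian half (✓`…PortS1LZdetReg.lzdetResidueOnReg_of_carriers`) needs the (63) resolvent identity (g1) at the pair of `U_{k+1}(W_B)` for every CLASS point `B`; the
letter `G3CPiecesAt` (✓`…G3CDefs`) records (g1) only as a germ `∀ᶠ B in 𝓝 0`, although the hand's inhabitant proves it for every pair by Finset algebra (the collector piece at `X_full`).  This file
re-exports the hand's construction with the pointwise clause — no new letter, no new estimate.
* ★★ `g3cPiecesAt_pointwise`.

HONEST FRAMING.  A re-packaging of ✓`g3cAtRecordL_holds` (hand-27930-G3C g1); its ANTECEDENT (the P0-ℂ body + (P4-lat), `stub_P0C`) is inhabited NOWHERE; nothing of Bałaban's RG estimates is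
asserted, ported or discharged here beyond what the hand landed; ⟨27930⟩ OPEN 1∕4 · no claim; NODE O 0∕1; COUNT 8∕28 · K 1∕4 UNMOVED; finite `𝕋⁴_{L^K}` at fixed ε — NOT continuum ∕ OS;
**the Yang–Mills mass gap (Clay) is NOT proved by any of this.**  No `sorry`, no `def`, no `instance`; standard axioms.
-/

noncomputable section

open scoped BigOperators Matrix.Norms.L2Operator Topology Matrix Classical
open Filter Finset

namespace Summit.QuantumFields.YangMills.Theorems.BalabanUVNodesPortS1

open Summit.QuantumFields.YangMills.Theorems.K0RecordFormatNames
open Literature.MathematicalPhysics.QuantumFieldTheory.Balaban1983to89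
open Literature.MathematicalPhysics.QuantumFieldTheory.Balaban1983to89.Node00
open Literature.MathematicalPhysics.QuantumFieldTheory.Balaban1983to89.T4Continuum (T4Family)
open Literature.MathematicalPhysics.QuantumFieldTheory.Balaban1983to89.TreeLengthTorus
open Literature.MathematicalPhysics.QuantumFieldTheory.Balaban1983to89.B12TreeDecay (K₀ kappa₀ K₀_pos kappa₀_nonneg)

variable (F : T4Family)

/-! ## ★★ The resummed resolvent pieces with (g1) AT EVERY PAIR (the hand's construction, re-exported) -/

/-- ★★ **`G3CAtRecordL`'s CONCLUSION ∧ (g1) POINTWISE**: for every target rate `κt > 0` and absolute constants `c₀ γ₀ γ₁ δ₁` there are `δG`, `Mth'` and (at `δ₀ ≥ δG`, `Mc ≥ Mth'`, `McGuard`) `Bc ≥ 0`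
such that every carrier family with the P0-ℂ body + (P4-lat) has resolvent pieces `(EG, EGZ)` with `G3CPiecesAt … κt Bc …` AND `Σ_X EG x n X φ = Tr (x + [TC n φ]_{non-b₀})⁻¹` for EVERY pair `φ`
and every `x ≥ 0` — the hand's collector identity ✓`sum_g3cEG` (germ-free), which the letter `G3CPiecesAt` records only as a germ.  Proof = ✓`g3cAtRecordL_holds` verbatim with the collector clause
kept. [cite: Balaban1985UV3, (23)–(25) p.262, (63) p.272; Balaban1985BackgroundPropagators, (3.87)–(3.96) pp.409–411; Balaban1983RegularityDecay, (5.6) p.594, (5.17) p.40; Balaban1987RG1, (1.7) p.261] -/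
theorem g3cPiecesAt_pointwise :
    ∀ κt : ℝ, 0 < κt → ∀ c₀ γ₀ γ₁ δ₁ : ℝ, 0 < c₀ → 0 < γ₀ → γ₀ ≤ γ₁ → 0 < δ₁ →
    ∃ δG : ℝ, 0 < δG ∧ ∃ Mth' : ℕ, ∀ δ₀ : ℝ, δG ≤ δ₀ → ∀ Mc : ℕ, Mth' ≤ Mc → McGuard F Mc →
    ∃ Bc : ℝ, 0 ≤ Bc ∧ ∀ a₀ α₀ α₁ ε₂₉ : ℝ, 0 < a₀ → 0 < α₀ → 0 < α₁ → 0 < ε₂₉ → ∀ (k : ℕ) TC TY TZY AdM AdZ,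
      P0CarrierClauses F a₀ δ₀ c₀ γ₀ γ₁ Mc α₀ α₁ ε₂₉ k TC TY TZY AdM AdZ → P0CarrierLatticeDecay F δ₀ c₀ δ₁ Mc α₀ α₁ k TY →
      ∃ EG EGZ, G3CPiecesAt F Mc k a₀ ε₂₉ α₀ α₁ κt Bc TC EG EGZ ∧
        ∀ (n : ℕ) (x : ℝ), 0 ≤ x → ∀ φ : Sect2.CPair (F.P (recordK₀ F Mc k + n)) (MatA 2),
          ∑ X : (recordDomSys F Mc k (recordK₀ F Mc k + n)).Dom, EG x n X φ =
            (((x : ℂ) • (1 : Matrix (NonB0Idx F k (recordK₀ F Mc k + n)) (NonB0Idx F k (recordK₀ F Mc k + n)) ℂ) +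
              Matrix.of (fun i j : NonB0Idx F k (recordK₀ F Mc k + n) => TC n φ i.1 j.1))⁻¹).trace := by
  intro κt hκt c₀ γ₀ γ₁ δ₁ hc₀ hγ₀ _hγ hδ₁
  have hc : (0 : ℝ) ≤ 2 * c₀ := by positivity
  have hγ : (0 : ℝ) < γ₀ / 2 := by positivity
  have hK₀ : 0 < K₀ (4 * 2 ^ 4 : ℝ) (2 * 4) := K₀_pos _ _
  obtain ⟨κ', hκ'def⟩ : ∃ κ' : ℝ, κ' = min (δ₁ / 2) (γ₀ / 2 * δ₁ / (4 * (2 * c₀ * K₀ (4 * 2 ^ 4) (2 * 4)))) := ⟨_, rfl⟩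
  have hden : (0 : ℝ) < 4 * (2 * c₀ * K₀ (4 * 2 ^ 4) (2 * 4)) := by positivity
  have hκ'0 : 0 < κ' := by rw [hκ'def]; exact lt_min (by positivity) (div_pos (by positivity) hden)
  have h2κ : 2 * κ' ≤ δ₁ := by
    have : κ' ≤ δ₁ / 2 := by rw [hκ'def]; exact min_le_left _ _
    linarith
  have h4κ : 4 * κ' * (2 * c₀ * K₀ (4 * 2 ^ 4) (2 * 4)) ≤ γ₀ / 2 * δ₁ := by
    have h1 : κ' ≤ γ₀ / 2 * δ₁ / (4 * (2 * c₀ * K₀ (4 * 2 ^ 4) (2 * 4))) := by rw [hκ'def]; exact min_le_right _ _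
    rw [le_div_iff₀ hden] at h1
    linarith
  obtain ⟨δG, hδG, Mth', hthr⟩ := exists_thresholds_g3cLam F hc hγ hκ'0 hκt.le
  refine ⟨δG, hδG, Mth', fun δ₀ hδ₀ Mc hMc hGuard => ?_⟩
  obtain ⟨hΛ, hδ₀'⟩ := hthr δ₀ hδ₀ Mc hMc
  obtain ⟨Bc, hBcdef⟩ : ∃ Bc : ℝ, Bc = 2 * ((((3 * 4 * (F.L * Mc) ^ 4 : ℕ) : ℝ)) * (1 / (γ₀ / 2)) * Real.exp (κt * ((3 ^ 4 * 3 ^ 4 : ℕ) : ℝ))) := ⟨_, rfl⟩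
  have hBc0 : 0 ≤ Bc := by rw [hBcdef]; positivity
  refine ⟨Bc, hBc0, fun a₀ α₀ α₁ ε₂₉ _ha₀ _hα₀ _hα₁ _hε k TC TY TZY AdM AdZ hP hL => ?_⟩
  refine ⟨fun x n X φ => g3cEG F Mc k (recordK₀ F Mc k + n) (TC n) (TY n) x X φ, fun x => g3cWZ F Mc TZY x, ?_, fun n x _ φ => sum_g3cEG Mc k (TC n) (TY n) x φ⟩
  refine ⟨fun n => ?_, fun n X => ?_, fun x n X φ ψ h => g3cEG_congr hP n x X h, fun x n X u φ => g3cEG_cAct hP n x X u φ, fun x _ => g3cEGZ_row hP hGuard x⟩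
  · exact Filter.Eventually.of_forall fun B x _ => sum_g3cEG Mc k (TC n) (TY n) x _
  · obtain ⟨O, hOo, hSO, hO⟩ := exists_open_g3cPt hP hL hc₀ hγ₀ n X
    have hEq : ∀ φ ∈ O, ∀ x : ℝ, 0 ≤ x →
        g3cEG F Mc k (recordK₀ F Mc k + n) (TC n) (TY n) x X φ = g3cW F Mc k (recordK₀ F Mc k + n) (TY n) x φ X := by
      intro φ hφ x hx
      by_cases hX : X = g3cFull F Mc k (recordK₀ F Mc k + n)
      · subst hX
        exact g3cEG_eq_g3cW_of_pt hP hGuard hc hγ hδ₁ hκ'0.le h2κ h4κ hκt.le hδ₀' hΛ n (hO φ hφ).1 hx _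
      · exact g3cEG_of_ne_full Mc k (TC n) (TY n) x φ hX
    refine ⟨O, hOo, hSO, fun x hx => ⟨?_, fun φ hφ => ?_⟩, fun φ hφ => ?_⟩
    · exact (differentiableOn_g3cW hP hGuard hc hγ hδ₁ hκ'0.le h2κ h4κ hκt.le hδ₀' hΛ n hOo hO hx).congr fun φ hφ => hEq φ hφ x hx
    · show ‖g3cEG F Mc k (recordK₀ F Mc k + n) (TC n) (TY n) x X φ‖ ≤ _
      rw [hEq φ hφ x hx]
      refine (norm_g3cW_le hP hGuard hc hγ hδ₁ hκ'0.le h2κ h4κ hκt.le hδ₀' hΛ n (hO φ hφ).1 hx).trans (le_of_eq ?_)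
      rw [hBcdef]
      simp only [T4Family.P_d]
      ring
    · exact (continuousOn_g3cW hP hGuard hc hγ hδ₁ hκ'0.le h2κ h4κ hκt.le hδ₀' hΛ n (hO φ hφ).1).congr fun x hx => hEq φ hφ x (Set.mem_Ici.1 hx)

end Summit.QuantumFields.YangMills.Theorems.BalabanUVNodesPortS1

end
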